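import Summits.RiemannHypothesis.RiemannHypothesis.Theses.GroundBarta
import Summits.RiemannHypothesis.RiemannHypothesis.Theorems.GroundBartaPolarPerronFrobeniusEvenRealGroundState
import Summits.RiemannHypothesis.RiemannHypothesis.Theorems.GroundBartaPolarPerronFrobeniusConeDenseOfEven
import Summits.RiemannHypothesis.RiemannHypothesis.Theorems.GroundBartaPolarPerronFrobeniusConeMinimizingSeq
import Summits.RiemannHypothesis.RiemannHypothesis.Theorems.GroundBartaPolarPerronFrobeniusAeNonnegOfL2Limit
import Literature.NumberTheory.LFunctions.WeilSemilocalCompactnessProofs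
import Literature.NumberTheory.LFunctions.WeilGroundEnergyParitySplit
import HarnessLib

/-!
# Crux `GroundBarta.PolarPerronFrobenius` (stmt-RiemannHypothesis-18390) — reduction to the
# even-cone density stub S1 (line `Sketch`, cone–compactness), sorry-free

With the three RH-free stubs of the line LANDED (`stub_coneDense_of_even` S2,
`stub_coneMinimizingSeq` S3, `stub_aeNonneg_of_L2_limit` S4), the lead's composition
(`Cruxes/PolarPerronFrobenius/Lines/Sketch.lean`, `PolarPerronFrobenius_of`) becomes an unconditional
IMPLICATION from the one remaining, RH-bearing stub S1 (`stub_evenConeDense_cofinal`: beyond every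
height there is a window at which an even-winning bottom makes even CONE tests energy-dense among even
tests) to the crux.  So after this file the crux `PolarPerronFrobenius` is EXACTLY S1: it closes by the
one-line transport `polarPerronFrobenius_of_evenConeDense_cofinal h` from any proof `h` of S1.

Proof (RH-free): at the window `a ≥ max A 1` of S1, an even-winning bottom gives even-cone density
(S1), hence cone density (S2), hence a normalised minimising sequence of cone tests (S3); the
compactness of the semilocal Weil form (Connes–Consani–Moscovici 2025 Thm 3.6, PROVED in tree as
`ConnesConsaniMoscovici2025_thm_3_6_holds`) extracts an `L²`-convergent subsequence, still minimising,
whose limit is a ground state in the junk-free encoding (`forall_eventually_le_iff_tendsto_weilGroundEnergy`)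
and a.e. real `≥ 0` (S4).  Mathlib + proved tree files only; no named fact; no definitions.
-/

set_option linter.dupNamespace false

noncomputable section

open Set MeasureTheory Filter Complex
open scoped Topology

namespace Summit.RiemannHypothesis.RiemannHypothesis.Theorems.PolarPerronFrobenius

open Literature.NumberTheory.LFunctions
open Summit.RiemannHypothesis.RiemannHypothesis.Theses.GroundBarta

/-- **`PolarPerronFrobenius` from the even-cone density stub S1 alone (RH-free reduction).**  If
beyond every height `A` there is a window `a ≥ A` at which an even-winning bottom forces even cone
tests (smooth, supported in `[-a, a]`, even, pointwise real and `≥ 0`, normalised) to be energy-dense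
among even normalised window tests, then `GroundBarta.PolarPerronFrobenius` holds. -/
theorem polarPerronFrobenius_of_evenConeDense_cofinal
    (h1 : ∀ A : ℝ, ∃ a : ℝ, A ≤ a ∧
      ((∀ o : ℝ → ℂ, IsWeilTest o → tsupport o ⊆ Set.Icc (-a) a →
            (∀ t, o (-t) = -o t) → ∫ t, ‖o t‖ ^ 2 = (1 : ℝ) → ∀ δ : ℝ, 0 < δ →
              ∃ w : ℝ → ℂ, IsWeilTest w ∧ tsupport w ⊆ Set.Icc (-a) a ∧ (∀ t, w (-t) = w t) ∧
                ∫ t, ‖w t‖ ^ 2 = (1 : ℝ) ∧ (weilQuadratic w).re ≤ (weilQuadratic o).re + δ) →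
        ∀ h : ℝ → ℂ, IsWeilTest h → tsupport h ⊆ Set.Icc (-a) a → (∀ t, h (-t) = h t) →
            ∫ t, ‖h t‖ ^ 2 = (1 : ℝ) → ∀ δ : ℝ, 0 < δ →
              ∃ w : ℝ → ℂ, IsWeilTest w ∧ tsupport w ⊆ Set.Icc (-a) a ∧ (∀ t, w (-t) = w t) ∧
                (∀ t, (w t).im = 0 ∧ 0 ≤ (w t).re) ∧ ∫ t, ‖w t‖ ^ 2 = (1 : ℝ) ∧
                (weilQuadratic w).re ≤ (weilQuadratic h).re + δ)) :
    Summit.RiemannHypothesis.RiemannHypothesis.Theses.GroundBarta.PolarPerronFrobenius := by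
  rw [show Summit.RiemannHypothesis.RiemannHypothesis.Theses.GroundBarta.PolarPerronFrobenius ↔
      ∀ A : ℝ, ∃ a : ℝ, A ≤ a ∧
        ((∀ o : ℝ → ℂ, IsWeilTest o → tsupport o ⊆ Icc (-a) a → (∀ t, o (-t) = -o t) →
            ∫ t, ‖o t‖ ^ 2 = (1 : ℝ) → ∀ δ : ℝ, 0 < δ → ∃ w : ℝ → ℂ, IsWeilTest w ∧
              tsupport w ⊆ Icc (-a) a ∧ (∀ t, w (-t) = w t) ∧ ∫ t, ‖w t‖ ^ 2 = (1 : ℝ) ∧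
              (weilQuadratic w).re ≤ (weilQuadratic o).re + δ) →
          ∃ u : ℝ → ℂ, (MemLp u 2 ∧ ∃ g : ℕ → ℝ → ℂ,
            (∀ n, IsWeilTest (g n) ∧ tsupport (g n) ⊆ Icc (-a) a ∧ ∫ t, ‖g n t‖ ^ 2 = (1 : ℝ)) ∧
            (∀ h : ℝ → ℂ, IsWeilTest h → tsupport h ⊆ Icc (-a) a → ∫ t, ‖h t‖ ^ 2 = (1 : ℝ) →
              ∀ δ : ℝ, 0 < δ → ∀ᶠ n in atTop, (weilQuadratic (g n)).re ≤ (weilQuadratic h).re + δ) ∧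
            Tendsto (fun n => ∫ t, ‖g n t - u t‖ ^ 2) atTop (nhds 0)) ∧
          (∀ᵐ t : ℝ, t ∈ Ioo (-a) a → (u t).im = 0 ∧ 0 ≤ (u t).re)) from Iff.rfl]
  intro A
  obtain ⟨a, ha, hS1⟩ := h1 (max A 1)
  have haA : A ≤ a := le_trans (le_max_left _ _) ha
  have ha0 : 0 < a := lt_of_lt_of_le one_pos (le_trans (le_max_right _ _) ha)
  refine ⟨a, haA, fun hEW => ?_⟩
  -- S1: even cone density at `a`; S2: cone density; S3: a minimising sequence of cone tests
  have hEven := hS1 hEW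
  have hCone := stub_coneDense_of_even a ha0 hEW hEven
  obtain ⟨g, hg, hQ⟩ := stub_coneMinimizingSeq a ha0 hCone
  -- compactness (CCM25 Thm 3.6, proved): an `L²`-convergent subsequence, still minimising
  have hg' : ∀ n, IsWeilTest (g n) ∧ tsupport (g n) ⊆ Icc (-a) a ∧ ∫ t, ‖g n t‖ ^ 2 = (1 : ℝ) :=
    fun n => ⟨(hg n).1, (hg n).2.1, (hg n).2.2.2⟩
  obtain ⟨u, hu, φ, hφ, hconv⟩ :=
    ConnesConsaniMoscovici2025_thm_3_6_holds a ha0 g hg' hQ.bddAbove_range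
  have hQ' : Tendsto (fun n ↦ (weilQuadratic (g (φ n))).re) atTop (𝓝 (weilGroundEnergy a)) :=
    hQ.comp hφ.tendsto_atTop
  refine ⟨u, ⟨hu, fun n => g (φ n), fun n => hg' (φ n),
    (forall_eventually_le_iff_tendsto_weilGroundEnergy (fun n => hg' (φ n))).2 hQ', hconv⟩, ?_⟩
  -- S4: the sign survives the `L²` limit
  have hmem : ∀ n, MemLp (g (φ n)) 2 := fun n =>
    (hg (φ n)).1.1.continuous.memLp_of_hasCompactSupport (hg (φ n)).1.2
  have hsign := stub_aeNonneg_of_L2_limit (fun n => g (φ n)) u hmem hu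
    (fun n t => (hg (φ n)).2.2.1 t) hconv
  exact hsign.mono fun t ht _ => ht

end Summit.RiemannHypothesis.RiemannHypothesis.Theorems.PolarPerronFrobenius

end
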